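import Summits.KontsevichZagierPeriods.Zeta5Search.Brown8.LeadingCoefficient
import Summits.KontsevichZagierPeriods.Zeta5Search.Families.CellularBrownZudilinGrowth

/-!
# Brown8 / LeadingCoefficientCone — the void sub-cone of Brown–Zudilin's family is a CONE: `Q(n·a) = 0` at one height iff at all (cert-1 g7)

HONEST FRAMING: systematic search; no irrationality claim unless certified.  Combinatorial statements about the leading
coefficient `Q(a)` (17) of [BrownZudilin2022] and corollaries CONDITIONAL on the printed decomposition (4) (Literature named
fact `BrownZudilin2022.decomposition`, taken as a hypothesis); nothing about the size of anything or about `ζ(5)`.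

Stage A (coordinator ruling 2026-08-22, SCOREBOARD §A column 'no-go theorem') counts CLASSES = directions `a` scanned along
their rays `n·a`.  `Brown8/LeadingCoefficient.liveBZ_iff_QOf_ne_zero` (fam-brown8 g11, p301535) says, for one convergent
vector, `LiveBZ a ↔ Q(a) ≠ 0`.  This file adds the ray statement the board needs:

* `liveBZ_smul_iff` — the twenty `σ_F`-valuations are homogeneous linear, so `LiveBZ (n·a) ↔ LiveBZ a` for every `n ≥ 1`;
* `QOf_smul_eq_zero_iff` — for convergent `a` and `n ≥ 1`: `Q(n·a) = 0 ↔ Q(a) = 0`; hence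
  `QOf_ray_eq_zero_iff` : `(∀ n ≥ 1, Q(n·a) = 0) ↔ ¬ LiveBZ a` and `QOf_ray_ne_zero_iff` : `(∀ n ≥ 1, Q(n·a) ≠ 0) ↔ LiveBZ a`
  — a direction is void at one height iff it is void at every height (the 'void sub-cone' of the census is a union of rays);
* `ray_mem_QZeta2_of_not_liveBZ` — CONDITIONAL on (4): off the live cone every form of the ray lies in `ℚζ(2) + ℚ`
  (`I(n·a) = -4P̂ₙζ(2) - 2Pₙ`): such a direction carries no `ζ(5)` (and no `ζ(3)`) at any height — it is not a
  `ζ(5)`-approximating family, whatever the census MODEL prints for it.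
-/

namespace Summit.KontsevichZagierPeriods.Zeta5Search.Families.Cellular

open Literature.NumberTheory.Irrationality
open Literature.NumberTheory.Irrationality.BrownZudilin2022
open Literature.NumberTheory.Transcendental (zetaValue)

/-- For an integer `L` and `n ≥ 1`: `2·(n·L) − 2 ≤ −1 ↔ 2·L − 2 ≤ −1` (both say `L ≤ 0`). -/
theorem twoVal_smul_iff {n : ℤ} (hn : 1 ≤ n) (L : ℤ) : 2 * (n * L) - 2 ≤ -1 ↔ 2 * L - 2 ≤ -1 := by
  constructor
  · intro h
    by_contra h'
    have hL : 1 ≤ L := by omega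
    nlinarith
  · intro h
    have hL : L ≤ 0 := by omega
    nlinarith

/-- **The live cone is a cone**: `LiveBZ (n·a) ↔ LiveBZ a` for `n ≥ 1` (the twenty `σ_F`-valuations are homogeneous linear
forms in `a`).  systematic search; no irrationality claim unless certified. -/
theorem liveBZ_smul_iff (a : Fin 8 → ℤ) {n : ℤ} (hn : 1 ≤ n) : LiveBZ (fun i => n * a i) ↔ LiveBZ a := by
  rw [XStarCover.liveBZ_iff, XStarCover.liveBZ_iff]
  have e : ∀ L : ℤ, (2 * (n * L) - 2 ≤ -1 ↔ 2 * L - 2 ≤ -1) := twoVal_smul_iff hn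
  have h1 := e (a 1 - a 3 + a 5 - a 6 - a 7)
  have h2 := e (-a 0 - a 1 + a 3 - a 5 + a 7)
  have h3 := e (-a 1 - a 2 - a 5 + a 6 + a 7)
  have h4 := e (-a 1 - a 2 + a 7)
  have h5 := e (-a 7)
  have h6 := e (a 1 + a 2 - a 3 - a 4 - a 7)
  have h7 := e (a 0 - a 2 - a 3)
  have h8 := e (-a 0 - a 6)
  have h9 := e (-a 0 + a 2 - a 4 - a 5)
  have h10 := e (-a 1 - a 2 + a 4)
  have h11 := e (-a 3 - a 4)
  have h12 := e (-a 1 - a 2 - a 5 + a 7)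
  have h13 := e (-a 0 - a 1 - a 4 - a 5 + a 7)
  have h14 := e (-a 0 + a 1 + a 2 - a 4 - a 6 - a 7)
  have h15 := e (-a 3 + a 5 - a 7)
  have h16 := e (-a 4 - a 5)
  have h17 := e (-a 0 + a 2 - a 4 - a 6)
  have h18 := e (-a 0 - a 1)
  have h19 := e (-a 4 - a 5 + a 7)
  have h20 := e (-a 0 + a 2 + a 5 - a 6 - a 7)
  ring_nf at h1 h2 h3 h4 h5 h6 h7 h8 h9 h10 h11 h12 h13 h14 h15 h16 h17 h18 h19 h20 ⊢
  rw [h1, h2, h3, h4, h5, h6, h7, h8, h9, h10, h11, h12, h13, h14, h15, h16, h17, h18, h19, h20]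

/-- **Void at one height iff void at every height**: for convergent `a` and `n ≥ 1`, `Q(n·a) = 0 ↔ Q(a) = 0`.
systematic search; no irrationality claim unless certified. -/
theorem QOf_smul_eq_zero_iff (a : Fin 8 → ℤ) (hc : Converges a) {n : ℤ} (hn : 1 ≤ n) :
    QOf (fun i => n * a i) = 0 ↔ QOf a = 0 := by
  have hcn : Converges (fun i => n * a i) := converges_smul hc (by omega)
  have h1 := liveBZ_iff_QOf_ne_zero _ hcn
  have h2 := liveBZ_iff_QOf_ne_zero a hc
  rw [liveBZ_smul_iff a hn] at h1
  constructor
  · intro h; by_contra h'; exact (h1.1 (h2.2 h')) h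
  · intro h; by_contra h'; exact (h2.1 (h1.2 h')) h

/-- **The void sub-cone is a union of rays**: for convergent `a`, `Q(n·a) = 0` for every `n ≥ 1` iff `a` is not live.
systematic search; no irrationality claim unless certified. -/
theorem QOf_ray_eq_zero_iff (a : Fin 8 → ℤ) (hc : Converges a) :
    (∀ n : ℤ, 1 ≤ n → QOf (fun i => n * a i) = 0) ↔ ¬ LiveBZ a := by
  rw [liveBZ_iff_QOf_ne_zero a hc, not_not]
  constructor
  · intro h
    have h1 := h 1 le_rfl
    simpa using h1
  · intro h n hn
    exact (QOf_smul_eq_zero_iff a hc hn).2 h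

/-- **Live at one height iff live at every height**: for convergent `a`, `Q(n·a) ≠ 0` for every `n ≥ 1` iff `a` is live.
systematic search; no irrationality claim unless certified. -/
theorem QOf_ray_ne_zero_iff (a : Fin 8 → ℤ) (hc : Converges a) :
    (∀ n : ℤ, 1 ≤ n → QOf (fun i => n * a i) ≠ 0) ↔ LiveBZ a := by
  rw [liveBZ_iff_QOf_ne_zero a hc]
  constructor
  · intro h
    have h1 := h 1 le_rfl
    simpa using h1
  · intro h n hn h0
    exact h ((QOf_smul_eq_zero_iff a hc hn).1 h0)

/-- **Off the live cone the whole ray carries no `ζ(5)`** — CONDITIONAL on BZ's decomposition (4) (named Literature fact used as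
a hypothesis): for convergent, non-live `a` and every `n ≥ 1`, `I(n·a) = r·ζ(2) + s` with `r, s ∈ ℚ`.  No irrationality content.
systematic search; no irrationality claim unless certified. -/
theorem ray_mem_QZeta2_of_not_liveBZ (hdec : decomposition) (a : Fin 8 → ℤ) (hc : Converges a) (hl : ¬ LiveBZ a)
    {n : ℤ} (hn : 1 ≤ n) : ∃ r s : ℚ, cellularIntegral (fun i => n * a i) = r * zetaValue 2 + s :=
  mem_QZeta2_of_not_liveBZ hdec _ (converges_smul hc (by omega)) (fun h => hl ((liveBZ_smul_iff a hn).1 h))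

end Summit.KontsevichZagierPeriods.Zeta5Search.Families.Cellular
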